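import Summits.AtomisticToContinuum.BoseEinsteinCondensation.Theorems.BECThomsonPrincipleGDTransferSeededGradingDefs
import Summits.AtomisticToContinuum.BoseEinsteinCondensation.Theorems.BECThomsonPrincipleGDTransferBareSecondVariationSlotDeriv
import Summits.AtomisticToContinuum.BoseEinsteinCondensation.Theorems.BECThomsonPrincipleGDTransferLnssAlgebraAdjoint
import Summits.AtomisticToContinuum.BoseEinsteinCondensation.Theorems.BECThomsonPrincipleGDTransferSeededPlainFormBridge

/-!
# Route `BECThomsonPrinciple`, crux `GDTransfer` (stmt-AtomisticToContinuum-9482), line `seeded-continuity`: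
# stub `kineticBlockDiagonal` — the kinetic form is diagonal in the `Q_S`-decomposition

Supports (does not close) stmt-AtomisticToContinuum-9482.  Fixed-`N` seed programme (fourth Defs file
`…SeededGradingDefs`), kinetic half of "`H = T + V` is band-diagonal in the `n̂₀`-grading": for `C¹` `f` and
`S ≠ T`, `t(Q_S f, Q_T f) = 0` (`KineticBlockDiagonal`), where `t(A, B) = ∫ Σ_{j,a} conj(∂_{j,a}A) ∂_{j,a}B`
(`tform`) and `Q_S = Π_{i∈S} P_i Π_{i∉S}(1 − P_i)` (`modeProj`, `P_i = cellAvg i` the average over particle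
`i`'s cell).

Mechanism (the kinetic twin of the `L²`-orthogonality `Lnss.integral_conj_modeProj_mul_modeProj`): pick
`l ∈ S ∆ T`, by conjugate symmetry of `t` say `l ∈ S ∖ T`, so that `A := Q_S f = P_l A` and `P_l B = 0` for
`B := Q_T f` (`Lnss.cellAvg_modeProj`).  The `j = l` terms vanish pointwise, `∂_{x_l}(P_l ·) = 0`
(`SecondVariation.fderiv_cellAvg_single_self`); for `j ≠ l`, `∂_{x_j}` commutes with `P_l`
(`SecondVariation.fderiv_cellAvg_single_of_ne`), and `P_l` is self-adjoint on the cell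
(`Negative.integral_conj_mul_cellAvg`), so `∫ conj(∂_jA) ∂_jB = ∫ conj(P_l ∂_jA) ∂_jB = ∫ conj(∂_jA) P_l ∂_jB =
∫ conj(∂_jA) ∂_j(P_l B) = 0`.  All [folklore] (LSSY2005 App. A; arXiv:1211.2778 §2).
-/

noncomputable section

open MeasureTheory Filter
open scoped ENNReal NNReal ComplexConjugate

namespace Summit.AtomisticToContinuum.BoseEinsteinCondensation.Cruxes.GDTransfer.Seeded

namespace KineticGrading

open Literature.MathematicalPhysics.QuantumManyBody.BoseGas
open Summit.AtomisticToContinuum.BoseEinsteinCondensation.Theorems.GaussianDominationCan.Negative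
open Summit.AtomisticToContinuum.BoseEinsteinCondensation.Cruxes.GDTransfer.DysonDressedWitness

variable {m : ℕ} {L : ℝ}

/-- One `(j, a)`-term `conj(∂_w A) ∂_w B` of the `t`-integrand is integrable on the cell for `C¹` data.
[folklore] -/
theorem integrable_tTerm {A B : Config (m + 1) → ℂ} (hA : ContDiff ℝ 1 A) (hB : ContDiff ℝ 1 B)
    (w : Config (m + 1)) :
    Integrable (fun X : Config (m + 1) => conj (fderiv ℝ A X w) * fderiv ℝ B X w)
      ((volume : Measure (Config (m + 1))).restrict (cellN (m + 1) L)) :=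
  integrableOn_cellN ((Complex.continuous_conj.comp
    ((hA.continuous_fderiv one_ne_zero).clm_apply continuous_const)).mul
    ((hB.continuous_fderiv one_ne_zero).clm_apply continuous_const)) L

/-- `t(A, B)` as the double sum of its slot integrals `∫ conj(∂_{j,a}A) ∂_{j,a}B` (`C¹` data). [folklore] -/
theorem tform_eq_sum {A B : Config (m + 1) → ℂ} (hA : ContDiff ℝ 1 A) (hB : ContDiff ℝ 1 B) :
    tform m L A B = ∑ j : Fin (m + 1), ∑ a : Fin 3, ∫ X in cellN (m + 1) L,
      conj (fderiv ℝ A X (Pi.single j (EuclideanSpace.single a (1 : ℝ)))) *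
        fderiv ℝ B X (Pi.single j (EuclideanSpace.single a (1 : ℝ))) := by
  unfold tform
  rw [integral_finsetSum _ fun j _ => integrable_finsetSum _ fun a _ => integrable_tTerm hA hB _]
  exact Finset.sum_congr rfl fun j _ => integral_finsetSum _ fun a _ => integrable_tTerm hA hB _

/-- **Slot mechanism**: if `A` is flat in slot `l` (`P_l A = A`) and `B` has zero slot-`l` average (`P_l B = 0`),
both `C¹`, then `t(A, B) = 0`.  The `j = l` terms vanish pointwise (`∂_{x_l} P_l = 0`); for `j ≠ l`,
`∂_{x_j}` commutes with the self-adjoint `P_l`. [folklore] -/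
theorem tform_eq_zero_of_flat (l : Fin (m + 1)) {A B : Config (m + 1) → ℂ} (hA : ContDiff ℝ 1 A)
    (hB : ContDiff ℝ 1 B) (hPA : cellAvg (m + 1) L l A = A) (hPB : cellAvg (m + 1) L l B = 0) :
    tform m L A B = 0 := by
  rw [tform_eq_sum hA hB]
  refine Finset.sum_eq_zero fun j _ => Finset.sum_eq_zero fun a _ => ?_
  set u : Space := EuclideanSpace.single a (1 : ℝ)
  rcases eq_or_ne j l with rfl | hjl
  · -- `∂_{x_j} A = ∂_{x_j} (P_j A) = 0` pointwise
    refine integral_eq_zero_of_ae (Eventually.of_forall fun X => ?_)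
    have h0 : fderiv ℝ A X (Pi.single j u) = 0 := by
      conv_lhs => rw [← hPA]
      exact SecondVariation.fderiv_cellAvg_single_self j hA X u
    simp only [Pi.zero_apply, h0, map_zero, zero_mul]
  · -- `j ≠ l`: `∂_j A = P_l ∂_j A`, move `P_l` across, `P_l ∂_j B = ∂_j P_l B = 0`
    have hcA : Continuous fun Y => fderiv ℝ A Y (Pi.single j u) :=
      (hA.continuous_fderiv one_ne_zero).clm_apply continuous_const
    have hcB : Continuous fun Y => fderiv ℝ B Y (Pi.single j u) :=
      (hB.continuous_fderiv one_ne_zero).clm_apply continuous_const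
    have hdA : ∀ X, fderiv ℝ A X (Pi.single j u) =
        cellAvg (m + 1) L l (fun Y => fderiv ℝ A Y (Pi.single j u)) X := fun X => by
      conv_lhs => rw [← hPA]
      exact SecondVariation.fderiv_cellAvg_single_of_ne hjl hA X u
    have hdB : ∀ X, cellAvg (m + 1) L l (fun Y => fderiv ℝ B Y (Pi.single j u)) X = 0 := fun X => by
      rw [← SecondVariation.fderiv_cellAvg_single_of_ne hjl hB X u, hPB, fderiv_zero]
      rfl
    calc ∫ X in cellN (m + 1) L, conj (fderiv ℝ A X (Pi.single j u)) * fderiv ℝ B X (Pi.single j u)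
        = ∫ X in cellN (m + 1) L,
            conj (cellAvg (m + 1) L l (fun Y => fderiv ℝ A Y (Pi.single j u)) X) *
              fderiv ℝ B X (Pi.single j u) :=
          integral_congr_ae (Eventually.of_forall fun X => by dsimp only; rw [← hdA X])
      _ = ∫ X in cellN (m + 1) L, conj (fderiv ℝ A X (Pi.single j u)) *
            cellAvg (m + 1) L l (fun Y => fderiv ℝ B Y (Pi.single j u)) X :=
          (integral_conj_mul_cellAvg l hcA hcB).symm
      _ = 0 := by simp only [hdB, mul_zero, integral_zero]

/-- **`t(Q_S f, Q_T f) = 0` when some slot `l ∈ S ∖ T`** (`C¹` `f`, `0 < L`): `Q_S f` is flat in slot `l` and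
`Q_T f` has zero slot-`l` average (`Lnss.cellAvg_modeProj`). [folklore] -/
theorem tform_modeProj_eq_zero_of_mem (hL : 0 < L) {S T : Finset (Fin (m + 1))} {l : Fin (m + 1)}
    (hlS : l ∈ S) (hlT : l ∉ T) {f : Config (m + 1) → ℂ} (hf : ContDiff ℝ 1 f) :
    tform m L (modeProj (m + 1) L S f) (modeProj (m + 1) L T f) = 0 := by
  have h1 := Lnss.cellAvg_modeProj hL S l hf.continuous
  have h2 := Lnss.cellAvg_modeProj hL T l hf.continuous
  rw [if_pos hlS] at h1
  rw [if_neg hlT] at h2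
  exact tform_eq_zero_of_flat l (Lnss.contDiff_modeProj S hf) (Lnss.contDiff_modeProj T hf) h1 h2

end KineticGrading

/-- **The kinetic form is diagonal in the `Q_S`-decomposition** (registered stub `kineticBlockDiagonal` of the
fixed-`N` seed programme): `t(Q_S f, Q_T f) = 0` for `S ≠ T` and `C¹` `f`.  Pick `l ∈ S ∆ T`; if `l ∈ S ∖ T` this is
`KineticGrading.tform_modeProj_eq_zero_of_mem`, otherwise its conjugate (`tform_conj_symm`). [folklore] -/
theorem kineticBlockDiagonal : KineticBlockDiagonal := by
  intro m L hL S T hST f hf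
  obtain ⟨l, hl⟩ : ∃ l, ¬(l ∈ S ↔ l ∈ T) := not_forall.1 fun h => hST (Finset.ext h)
  by_cases hlS : l ∈ S
  · exact KineticGrading.tform_modeProj_eq_zero_of_mem hL hlS (fun h => hl (iff_of_true hlS h)) hf
  · have hlT : l ∈ T := of_not_not fun h => hl (iff_of_false hlS h)
    rw [PlainCost.tform_conj_symm, KineticGrading.tform_modeProj_eq_zero_of_mem hL hlT hlS hf,
      map_zero]

end Summit.AtomisticToContinuum.BoseEinsteinCondensation.Cruxes.GDTransfer.Seeded

end
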